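import Literature.Analysis.FluidPDE.PassiveVectorTensorWeakContinuity
import Literature.Analysis.FluidPDE.PassiveVectorTensorSuperposition
import Literature.Analysis.FluidPDE.PassiveVectorTensorRestart
import Literature.Analysis.FluidPDE.PassiveScalarDiagForcedTrace
import HarnessLib

/-!
# Weak passive solenoidal vectors with a constant viscosity tensor: the weakly continuous `L²`-valued
# representative and its trace identities at EVERY time

Analysis/FluidPDE proof-support file (everything proved; no definitions, no named facts).  A weak solution
`w ∈ L^∞(0,T; L²(T^d; ℝ^d))` of `Torus.IsWeakTensorPassiveVectorOn A T 𝔸 b w₀ w` is determined for a.e. `t` only.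
For the WINDOW PROPAGATOR of the linear problem (cell `ad-ideate`, crux K1L_D, tenure D24-7 «S0′»: the two-parameter
solution operator `U(s,t)` on `L²`, its cocycle, and the restart at the refresh times of a Lagrangian carrier) one
needs the value of `w` at EVERY prescribed time, with the trace identities that `PassiveVectorTensorRestart.translate_time`
consumes.  This file builds the `C([0,T]; L²_w)` representative — the vector twin of the scalar
`PassiveScalarDiagForcedTrace.exists_weaklyContinuous_representative` (DiPerna–Lions 1989 §II.1; De Lellis–Székelyhidi
2010, Lemma 7.1 / App. A; Temam 1984, Ch. III §1 Lemma 1.4):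

* `IsWeakTensorPassiveVectorOn.exists_continuousOn_componentCoeff` — continuous-in-time Fourier coefficients, componentwise;
* `IsWeakTensorPassiveVectorOn.exists_weaklyContinuous_representative` — for `T > 0` and a weakly divergence-free
  `L²` datum there is `W : ℝ → T^d → ℝ^d` with: `W t ∈ L²` and `∫‖W t‖² ≤ C` for all `t ≥ 0` (`C` the class bound);
  every a.e. energy bound `∫‖w t‖² ≤ M` on `(0,T)` holds for `W` at EVERY `t ∈ [0,T]` (e.g. `M = ∫‖w₀‖²` under
  `PassiveVectorTensorWeakContinuity.ae_integral_norm_sq_le`: the contraction property of the solution map at every time);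
  `W t = w t` a.e. in `x` for a.e. `t ∈ (0,T)`; `W 0 = w₀` a.e.; `t ↦ ∫⟪W t, φ⟫` continuous on `[0,T]` for every
  `φ ∈ L²`; `W t` weakly divergence free for EVERY `t ∈ [0,T]`; and the TRACE IDENTITIES
  `∫⟪W σ, G⟫ = ∫⟪w₀, G⟫ + ∫_{(0,σ]} (∫⟪w, (b·∇)G + 𝓛_𝔸^*G⟫ + A∫⟪b, (w·∇)G⟫)` for every smooth divergence-free `G` and
  EVERY `σ ∈ [0,T]` (so `W σ` is an admissible restart datum at `σ` for `translate_time`, and two solutions with the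
  same datum have the same `W σ` by uniqueness — the ingredients of the two-parameter propagator).

Construction: componentwise.  For each coordinate `i` and frequency `k` the class gives a continuous representative of
`t ↦ 𝓕(w t)ᵢ(k)` taking the datum's coefficient at `0` (`exists_continuousOn_inner_mFourierCoeff`, amendment 1 of
`PassiveVectorTensorWeakContinuity`); finite Bessel sums and the reality symmetry pass from a.e. `t` to every `t ∈ [0,T]` by
continuity; the parametrised Riesz–Fischer theorem (`exists_realScalarField_forall_mFourierCoeff_eq`,
`TransportWeakExistenceProofs`) realises each component; weak continuity by `continuousOn_integral_mul_of_coeff`; the trace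
identities for smooth divergence-free `G` by continuity of both sides on `[0,T]` (`ae_integral_inner_eq` + the primitive of
`integrableOn_steadyRHS`).

## Mathlib / tree search

Tree: `PassiveVectorTensorWeakContinuity.exists_continuousOn_inner_mFourierCoeff`, `…ae_integral_norm_sq_le`,
`PassiveVectorTensorClass.ae_integral_inner_eq`, `…integrableOn_steadyRHS`, `…ae_lintegral_sq_le`, `…ae_memLp_two`,
`…ae_isWeaklyDivFree`, `TransportWeakExistenceProofs.exists_realScalarField_forall_mFourierCoeff_eq`,
`…continuousOn_integral_mul_of_coeff`, `…ae_eq_of_forall_mFourierCoeff_ofReal_eq`, `TorusSobolevNorm.mFourierCoeff_complexify_apply`,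
`TorusScalarTrigPoly.isConjSymmScalar_mFourierCoeff`, `…hasSum_sq_norm_mFourierCoeff_ofReal`, Mathlib `Measure.eqOn_Icc_of_ae_eq`.

## References

* R. J. DiPerna, P.-L. Lions, Invent. Math. 98 (1989), §II.1, (12)–(14). [`DiPernaLions1989`]
* C. De Lellis, L. Székelyhidi Jr., Arch. Ration. Mech. Anal. 195 (2010), Lemma 7.1, App. A. [`DeLellisSzekelyhidi2010`]
* R. Temam, *Navier–Stokes Equations*, 3rd ed. (1984), Ch. III §1, Lemma 1.4. [`Temam1984`]
-/

noncomputable section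

open MeasureTheory Set Filter Function TopologicalSpace Complex UnitAddTorus
open scoped ENNReal NNReal InnerProductSpace Topology ComplexConjugate

namespace Literature.Analysis.FluidPDE

namespace Torus

variable {d : Type*} [Fintype d] [DecidableEq d]

/-! ## Tools: a.e. on `(0,T)` versus everywhere on `[0,T]`; vector fields from scalar components -/

section Tools

omit [Fintype d] [DecidableEq d] in
/-- Two functions continuous on `[0,T]` that agree a.e. on `(0,T)` agree on `[0,T]`. [folklore] -/
private theorem eqOn_Icc_of_ae_restrict_Ioo' {Y : Type*} [TopologicalSpace Y] [T2Space Y] {T : ℝ}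
    (hT : 0 < T) {f g : ℝ → Y} (hf : ContinuousOn f (Icc 0 T)) (hg : ContinuousOn g (Icc 0 T))
    (h : ∀ᵐ t ∂(volume.restrict (Ioo 0 T)), f t = g t) : EqOn f g (Icc 0 T) := by
  refine Measure.eqOn_Icc_of_ae_eq (μ := volume) hT.ne ?_ hf hg
  have e : (volume : Measure ℝ).restrict (Icc 0 T) = volume.restrict (Ioo 0 T) :=
    Measure.restrict_congr_set Ioo_ae_eq_Icc.symm
  rw [e]
  exact h

omit [Fintype d] [DecidableEq d] in
/-- An a.e. upper bound on `(0,T)` for a function continuous on `[0,T]` holds on all of `[0,T]`. [folklore] -/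
private theorem le_on_Icc_of_ae_restrict_Ioo' {T : ℝ} (hT : 0 < T) {f : ℝ → ℝ} {M : ℝ}
    (hf : ContinuousOn f (Icc 0 T)) (h : ∀ᵐ t ∂(volume.restrict (Ioo 0 T)), f t ≤ M) :
    ∀ t ∈ Icc 0 T, f t ≤ M := by
  have key := eqOn_Icc_of_ae_restrict_Ioo' (Y := ℝ) hT (hf.sup continuousOn_const) continuousOn_const
    (f := fun t => max (f t) M) (g := fun _ => M) (by filter_upwards [h] with t ht; exact max_eq_right ht)
  intro t ht
  have h1 : max (f t) M = M := key ht
  exact (le_max_left _ _).trans h1.le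

omit [Fintype d] [DecidableEq d] in
/-- The vector field with scalar components `a i`. [folklore] -/
private theorem toLp_apply' (a : d → ℝ) (j : d) : (WithLp.toLp 2 a : EuclideanSpace ℝ d) j = a j := rfl

omit [DecidableEq d] in
/-- A component is bounded by the Euclidean norm: `(v j)² ≤ ‖v‖²`. [folklore] -/
private theorem sq_apply_le_norm_sq (v : EuclideanSpace ℝ d) (j : d) : v j ^ 2 ≤ ‖v‖ ^ 2 := by
  rw [EuclideanSpace.norm_sq_eq]
  have : v j ^ 2 = ‖v j‖ ^ 2 := by rw [Real.norm_eq_abs, sq_abs]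
  rw [this]
  exact Finset.single_le_sum (f := fun i => ‖v i‖ ^ 2) (fun i _ => sq_nonneg _) (Finset.mem_univ j)

omit [DecidableEq d] in
/-- `‖v‖² = Σⱼ (v j)²`. [folklore] -/
private theorem norm_sq_eq_sum_sq (v : EuclideanSpace ℝ d) : ‖v‖ ^ 2 = ∑ j, v j ^ 2 := by
  rw [EuclideanSpace.norm_sq_eq]
  exact Finset.sum_congr rfl fun j _ => by rw [Real.norm_eq_abs, sq_abs]

omit [DecidableEq d] in
/-- A vector field assembled from scalar components is the sum of the components times the standard basis. [folklore] -/
private theorem toLp_eq_sum_smul_basisFun (a : d → ℝ) :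
    (WithLp.toLp 2 a : EuclideanSpace ℝ d) = ∑ i, a i • EuclideanSpace.basisFun d ℝ i := by
  conv_lhs => rw [← (EuclideanSpace.basisFun d ℝ).sum_repr (WithLp.toLp 2 a)]
  exact Finset.sum_congr rfl fun i _ => by rw [EuclideanSpace.basisFun_repr]

omit [DecidableEq d] in
/-- A vector field assembled from `L²` components is in `L²`. [folklore] -/
private theorem memLp_two_toLp {f : d → UnitAddTorus d → ℝ} (hf : ∀ i, MemLp (f i) 2 volume) :
    MemLp (fun x => (WithLp.toLp 2 fun i => f i x : EuclideanSpace ℝ d)) 2 volume := by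
  have e : (fun x => (WithLp.toLp 2 fun i => f i x : EuclideanSpace ℝ d)) =
      fun x => ∑ i, f i x • EuclideanSpace.basisFun d ℝ i := by
    funext x
    exact toLp_eq_sum_smul_basisFun _
  rw [e]
  refine memLp_finsetSum (ε' := EuclideanSpace ℝ d) _ fun i _ => ?_
  exact MemLp.of_le_mul (c := ‖EuclideanSpace.basisFun d ℝ i‖) (hf i) ((hf i).1.smul_const _)
    (Eventually.of_forall fun x => by rw [norm_smul, mul_comm])

omit [DecidableEq d] in
/-- The real inner product of two vectors, as the sum of the products of components. [folklore] -/
private theorem inner_eq_sum_mul' (u v : EuclideanSpace ℝ d) : ⟪u, v⟫_ℝ = ∑ i, u i * v i := by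
  rw [PiLp.inner_apply]
  refine Finset.sum_congr rfl fun i _ => ?_
  simp [mul_comm]


/-- Real form of an `ℝ≥0∞` bound on `∫⁻ ‖v‖ₑ²` for `v ∈ L²`. [folklore] -/
private theorem integral_norm_sq_le_of_lintegral_le' {α : Type*} [MeasurableSpace α] {μ : Measure α}
    {E : Type*} [NormedAddCommGroup E] {v : α → E} (hv : MemLp v 2 μ) {C : ℝ≥0}
    (h : ∫⁻ x, ‖v x‖ₑ ^ 2 ∂μ ≤ C) : ∫ x, ‖v x‖ ^ 2 ∂μ ≤ C := by
  have e : ∫⁻ x, ‖v x‖ₑ ^ 2 ∂μ = ENNReal.ofReal (∫ x, ‖v x‖ ^ 2 ∂μ) := by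
    rw [ofReal_integral_eq_lintegral_ofReal (hv.integrable_norm_pow two_ne_zero) (ae_of_all _ fun x => by positivity)]
    refine lintegral_congr_ae (ae_of_all _ fun x => ?_)
    dsimp only
    rw [ENNReal.ofReal_pow (norm_nonneg _), ofReal_norm]
  rw [e] at h
  exact (ENNReal.ofReal_le_iff_le_toReal ENNReal.coe_ne_top).1 h |>.trans_eq (ENNReal.coe_toReal C)

omit [DecidableEq d] in
/-- A component of an `L²` vector field is an `L²` scalar field. [folklore] -/
private theorem memLp_two_coord {v : UnitAddTorus d → EuclideanSpace ℝ d} (hv : MemLp v 2 volume) (i : d) :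
    MemLp (fun x => v x i) 2 volume := by
  refine MemLp.of_le hv ((PiLp.continuous_apply 2 (fun _ : d => ℝ) i).comp_aestronglyMeasurable hv.1)
    (ae_of_all _ fun x => ?_)
  rw [Real.norm_eq_abs]
  exact abs_le_norm_of_sq_le_sq' (v x) i
where
  /-- `|v i| ≤ ‖v‖`. -/
  abs_le_norm_of_sq_le_sq' (v : EuclideanSpace ℝ d) (i : d) : |v i| ≤ ‖v‖ :=
    abs_le.2 (abs_le_of_sq_le_sq' (sq_apply_le_norm_sq v i) (norm_nonneg _))

omit [DecidableEq d] in
/-- `⟪f, g⟫` is integrable for `f, g ∈ L²(T^d; ℝ^d)` (Cauchy–Schwarz). [folklore] -/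
private theorem integrable_inner_of_memLp_two_vec {f g : UnitAddTorus d → EuclideanSpace ℝ d} (hf : MemLp f 2 volume)
    (hg : MemLp g 2 volume) : Integrable (fun x => ⟪f x, g x⟫_ℝ) volume := by
  have h : MemLp ((fun x => ‖g x‖) * fun x => ‖f x‖) 1 volume := hf.norm.mul hg.norm
  refine (memLp_one_iff_integrable.1 h).mono' (hf.1.inner hg.1) (Eventually.of_forall fun x => ?_)
  rw [Pi.mul_apply, Real.norm_eq_abs, mul_comm]
  exact abs_real_inner_le_norm _ _

omit [DecidableEq d] in
/-- `∫ ‖v‖² = Σᵢ ∫ (v i)²` for `v ∈ L²`. [folklore] -/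
private theorem integral_norm_sq_eq_sum_sq_apply (v : UnitAddTorus d → EuclideanSpace ℝ d) (hv : MemLp v 2 volume) :
    ∫ x, ‖v x‖ ^ 2 = ∑ i, ∫ x, (v x i) ^ 2 := by
  rw [← integral_finsetSum _ fun i _ => (memLp_two_coord hv i).integrable_sq]
  exact integral_congr_ae (ae_of_all _ fun x => norm_sq_eq_sum_sq (v x))

end Tools

namespace IsWeakTensorPassiveVectorOn

variable {A T : ℝ} {𝔸 : Visc4 d} {b w : ℝ → UnitAddTorus d → EuclideanSpace ℝ d}
  {w₀ : UnitAddTorus d → EuclideanSpace ℝ d}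

/-! ## Continuous component coefficients -/

/-- **Continuous Fourier coefficients, componentwise**: for a weakly divergence-free `L²` datum there is a family
`c i t k`, continuous in `t` on `[0,T]` for each `(i,k)`, equal to the datum's coefficients at `t = 0` and to the
coefficients of the `i`-th component of `w t` for a.e. `t ∈ (0,T)` (all `i, k` simultaneously).
[cite: Temam1984, Ch. III §1 Lemma 1.4] -/
theorem exists_continuousOn_componentCoeff (h : IsWeakTensorPassiveVectorOn A T 𝔸 b w₀ w)
    (hw₀ : MemLp w₀ 2 volume) (hdiv₀ : FunctionSpaces.Torus.IsWeaklyDivFree w₀) :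
    ∃ c : d → ℝ → (d → ℤ) → ℂ,
      (∀ i k, ContinuousOn (fun t => c i t k) (Icc 0 T)) ∧
      (∀ i k, c i 0 k = mFourierCoeff (fun x => ((w₀ x i : ℝ) : ℂ)) k) ∧
      (∀ᵐ t ∂(volume.restrict (Ioo 0 T)), ∀ i k, c i t k = mFourierCoeff (fun x => ((w t x i : ℝ) : ℂ)) k) := by
  have hw₀i : Integrable w₀ volume := hw₀.integrable one_le_two
  have key : ∀ i : d, ∀ k : d → ℤ, ∃ g : ℝ → ℂ, ContinuousOn g (Icc 0 T) ∧
      g 0 = ⟪mFourierCoeff (FunctionSpaces.EuclideanSpace.complexify ∘ w₀) k, EuclideanSpace.single i (1:ℂ)⟫_ℂ ∧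
      ∀ᵐ t ∂(volume.restrict (Ioo 0 T)),
        ⟪mFourierCoeff (FunctionSpaces.EuclideanSpace.complexify ∘ w t) k, EuclideanSpace.single i (1:ℂ)⟫_ℂ = g t :=
    fun i k => h.exists_continuousOn_inner_mFourierCoeff hw₀ hdiv₀ k (EuclideanSpace.single i (1:ℂ))
  choose g hgc hg0 hgae using key
  refine ⟨fun i t k => conj (g i k t), fun i k => (Complex.continuous_conj.comp_continuousOn (hgc i k)), fun i k => ?_, ?_⟩
  · show conj (g i k 0) = _
    rw [hg0 i k, EuclideanSpace.inner_single_right, one_mul, conj_conj,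
      FunctionSpaces.Torus.mFourierCoeff_complexify_apply hw₀i k i]
  · have hall : ∀ᵐ t ∂(volume.restrict (Ioo 0 T)), ∀ i k,
        ⟪mFourierCoeff (FunctionSpaces.EuclideanSpace.complexify ∘ w t) k, EuclideanSpace.single i (1:ℂ)⟫_ℂ = g i k t :=
      ae_all_iff.2 fun i => ae_all_iff.2 fun k => hgae i k
    filter_upwards [hall, h.ae_memLp_two] with t ht htm i k
    have hI : Integrable (w t) volume := htm.integrable one_le_two
    show conj (g i k t) = _
    rw [← ht i k, EuclideanSpace.inner_single_right, one_mul, conj_conj,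
      FunctionSpaces.Torus.mFourierCoeff_complexify_apply hI k i]

/-! ## The weakly continuous representative and its traces -/

/-- **The `C([0,T]; L²_w)` representative of a weak tensor-viscosity passive vector, and its traces.**  For `T > 0` and a
weakly divergence-free `L²` datum there is `W : ℝ → T^d → ℝ^d` with: `W t ∈ L²` and `∫‖W t‖² ≤ C` for all `t ≥ 0` (`C` the
class's `L^∞_t L²_x` bound) and, for every `M`, an a.e. bound `∫‖w t‖² ≤ M` on `(0,T)` passes to `∫‖W t‖² ≤ M` for EVERY
`t ∈ [0,T]` (energy inequalities survive at every time); `W t = w t` a.e. for a.e. `t ∈ (0,T)`; `W 0 = w₀` a.e.;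
`t ↦ ∫⟪W t, φ⟫` continuous on `[0,T]` for every `φ ∈ L²`; `W t` weakly divergence free for every `t ∈ [0,T]`; and the TRACE IDENTITIES against every smooth
divergence-free steady `G` at EVERY `σ ∈ [0,T]` (the hypothesis of `translate_time`).  (Beyond `T` the field is clamped,
`W t = W T`.) [cite: DeLellisSzekelyhidi2010, Lemma 7.1] [cite: Temam1984, Ch. III §1 Lemma 1.4] -/
theorem exists_weaklyContinuous_representative [Nonempty d] (h : IsWeakTensorPassiveVectorOn A T 𝔸 b w₀ w) (hT : 0 < T)
    (hw₀ : MemLp w₀ 2 volume) (hdiv₀ : FunctionSpaces.Torus.IsWeaklyDivFree w₀) :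
    ∃ W : ℝ → UnitAddTorus d → EuclideanSpace ℝ d,
      (∀ t, 0 ≤ t → MemLp (W t) 2 volume) ∧
      (∃ C : ℝ≥0, ∀ t, 0 ≤ t → ∫ x, ‖W t x‖ ^ 2 ≤ C) ∧
      (∀ M : ℝ, (∀ᵐ t ∂(volume.restrict (Ioo 0 T)), ∫ x, ‖w t x‖ ^ 2 ≤ M) →
        ∀ t ∈ Icc 0 T, ∫ x, ‖W t x‖ ^ 2 ≤ M) ∧
      (∀ᵐ t ∂(volume.restrict (Ioo 0 T)), W t =ᵐ[volume] w t) ∧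
      (W 0 =ᵐ[volume] w₀) ∧
      (∀ φ : UnitAddTorus d → EuclideanSpace ℝ d, MemLp φ 2 volume →
        ContinuousOn (fun t => ∫ x, ⟪W t x, φ x⟫_ℝ) (Icc 0 T)) ∧
      (∀ t ∈ Icc 0 T, FunctionSpaces.Torus.IsWeaklyDivFree (W t)) ∧
      (∀ G : UnitAddTorus d → EuclideanSpace ℝ d, FunctionSpaces.Torus.IsSmooth G → FunctionSpaces.Torus.IsDivFree G →
        ∀ σ ∈ Icc 0 T, ∫ x, ⟪W σ x, G x⟫_ℝ = (∫ x, ⟪w₀ x, G x⟫_ℝ) +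
          ∫ τ in Ioc 0 σ, ((∫ x, ⟪w τ x, FunctionSpaces.Torus.convect (b τ) G x + viscAdj 𝔸 G x⟫_ℝ) +
            A * ∫ x, ⟪b τ x, FunctionSpaces.Torus.convect (w τ) G x⟫_ℝ)) := by
  -- continuous component coefficients
  obtain ⟨c, hcc, hc0, hcid⟩ := h.exists_continuousOn_componentCoeff hw₀ hdiv₀
  -- the class bound in real form
  obtain ⟨C, hC⟩ := h.ae_lintegral_sq_le
  have hbd : ∀ᵐ t ∂(volume.restrict (Ioo 0 T)), ∫ x, ‖w t x‖ ^ 2 ≤ (C : ℝ) := by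
    filter_upwards [hC, h.ae_memLp_two] with t ht hm
    exact integral_norm_sq_le_of_lintegral_le' hm ht
  -- joint finite Bessel sums, for every `t ∈ [0,T]`, under any a.e. energy bound `M`
  have hsumM : ∀ M : ℝ, (∀ᵐ t ∂(volume.restrict (Ioo 0 T)), ∫ x, ‖w t x‖ ^ 2 ≤ M) →
      ∀ t ∈ Icc 0 T, ∀ F : Finset (d → ℤ), ∑ k ∈ F, ∑ i, ‖c i t k‖ ^ 2 ≤ M := by
    intro M hM t ht F
    refine le_on_Icc_of_ae_restrict_Ioo' hT (f := fun t => ∑ k ∈ F, ∑ i, ‖c i t k‖ ^ 2)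
      (continuousOn_finsetSum _ fun k _ => continuousOn_finsetSum _ fun i _ => ((hcc i k).norm).pow 2) ?_ t ht
    filter_upwards [hcid, h.ae_memLp_two, hM] with τ hτ hτm hτb
    have e : ∑ k ∈ F, ∑ i, ‖c i τ k‖ ^ 2 = ∑ i, ∑ k ∈ F, ‖mFourierCoeff (fun x => ((w τ x i : ℝ) : ℂ)) k‖ ^ 2 := by
      rw [Finset.sum_comm]
      exact Finset.sum_congr rfl fun i _ => Finset.sum_congr rfl fun k _ => by rw [hτ i k]
    show ∑ k ∈ F, ∑ i, ‖c i τ k‖ ^ 2 ≤ _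
    rw [e]
    calc ∑ i, ∑ k ∈ F, ‖mFourierCoeff (fun x => ((w τ x i : ℝ) : ℂ)) k‖ ^ 2 ≤ ∑ i, ∫ x, (w τ x i) ^ 2 :=
          Finset.sum_le_sum fun i _ => sum_le_hasSum F (fun k _ => sq_nonneg _)
            (FunctionSpaces.Torus.hasSum_sq_norm_mFourierCoeff_ofReal (memLp_two_coord hτm i))
      _ = ∫ x, ‖w τ x‖ ^ 2 := (integral_norm_sq_eq_sum_sq_apply _ hτm).symm
      _ ≤ M := hτb
  have hsum : ∀ t ∈ Icc 0 T, ∀ F : Finset (d → ℤ), ∑ k ∈ F, ∑ i, ‖c i t k‖ ^ 2 ≤ (C : ℝ) := hsumM C hbd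
  have hsum1 : ∀ i, ∀ t ∈ Icc 0 T, ∀ F : Finset (d → ℤ), ∑ k ∈ F, ‖c i t k‖ ^ 2 ≤ (C : ℝ) := by
    intro i t ht F
    refine le_trans (Finset.sum_le_sum fun k _ => ?_) (hsum t ht F)
    exact Finset.single_le_sum (f := fun j => ‖c j t k‖ ^ 2) (fun j _ => sq_nonneg _) (Finset.mem_univ i)
  -- the reality condition, for every `t ∈ [0,T]`
  have hsym : ∀ i, ∀ t ∈ Icc 0 T, ∀ k, c i t (-k) = conj (c i t k) := by
    intro i t ht k
    refine eqOn_Icc_of_ae_restrict_Ioo' (Y := ℂ) hT (f := fun t => c i t (-k))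
      (g := fun t => conj (c i t k)) (hcc i (-k)) (Complex.continuous_conj.comp_continuousOn (hcc i k)) ?_ ht
    filter_upwards [hcid] with τ hτ
    rw [hτ i (-k), hτ i k]
    exact FunctionSpaces.Torus.isConjSymmScalar_mFourierCoeff (fun x => w τ x i) k
  -- clamp to `[0,T]`
  have hcl : ∀ t : ℝ, (Set.projIcc 0 T hT.le t : ℝ) ∈ Icc 0 T := fun t => (Set.projIcc 0 T hT.le t).2
  have hcl_eq : ∀ t ∈ Icc 0 T, (Set.projIcc 0 T hT.le t : ℝ) = t := fun t ht => by
    rw [Set.projIcc_of_mem hT.le ht]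
  set cc : d → ℝ → (d → ℤ) → ℂ := fun i t k => c i (Set.projIcc 0 T hT.le t : ℝ) k with hcc_def
  have hccc : ∀ i k, ContinuousOn (fun t => cc i t k) (Ici 0) := fun i k =>
    ((hcc i k).comp (continuous_subtype_val.comp continuous_projIcc).continuousOn fun t _ => hcl t)
  have hcccI : ∀ i k, ContinuousOn (fun t => cc i t k) (Icc 0 T) := fun i k => (hccc i k).mono Icc_subset_Ici_self
  have hccsum : ∀ i, ∀ t, 0 ≤ t → ∀ F : Finset (d → ℤ), ∑ k ∈ F, ‖cc i t k‖ ^ 2 ≤ (C : ℝ) :=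
    fun i t _ F => hsum1 i _ (hcl t) F
  have hccsym : ∀ i, ∀ t, 0 ≤ t → ∀ k, cc i t (-k) = conj (cc i t k) := fun i t _ k => hsym i _ (hcl t) k
  -- Riesz–Fischer, componentwise
  have hRF : ∀ i, ∃ f : ℝ → UnitAddTorus d → ℝ,
      AEStronglyMeasurable (FunctionSpaces.Torus.stLift f) (volume.restrict (Ioi 0 ×ˢ univ)) ∧
      ∀ t, 0 ≤ t → MemLp (f t) 2 volume ∧ ∀ k, mFourierCoeff (fun x => ((f t x : ℝ) : ℂ)) k = cc i t k :=
    fun i => exists_realScalarField_forall_mFourierCoeff_eq (hccc i) (hccsum i) (hccsym i)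
  choose f _hfm hf using hRF
  -- the representative
  obtain ⟨W, hWdef⟩ : ∃ W : ℝ → UnitAddTorus d → EuclideanSpace ℝ d, W = fun t x => WithLp.toLp 2 fun i => f i t x :=
    ⟨_, rfl⟩
  have hWapp : ∀ t x i, W t x i = f i t x := fun t x i => by rw [hWdef]
  have hWmem : ∀ t, 0 ≤ t → MemLp (W t) 2 volume := fun t ht => by
    rw [hWdef]; exact memLp_two_toLp fun i => (hf i t ht).1
  -- energy bound for every `t ≥ 0`
  have hWsq : ∀ t, 0 ≤ t → ∫ x, ‖W t x‖ ^ 2 ≤ (C : ℝ) := by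
    intro t ht
    rw [integral_norm_sq_eq_sum_sq_apply _ (hWmem t ht)]
    have hP : ∀ i, HasSum (fun k : d → ℤ => ‖cc i t k‖ ^ 2) (∫ x, (W t x i) ^ 2) := by
      intro i
      have hh := FunctionSpaces.Torus.hasSum_sq_norm_mFourierCoeff_ofReal (hf i t ht).1
      simp only [hWapp]
      convert hh using 1
      funext k
      rw [(hf i t ht).2 k]
    have hS : HasSum (fun k : d → ℤ => ∑ i, ‖cc i t k‖ ^ 2) (∑ i, ∫ x, (W t x i) ^ 2) := hasSum_sum fun i _ => hP i
    rw [← hS.tsum_eq]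
    exact hS.summable.tsum_le_of_sum_le fun F => by
      have := hsum _ (hcl t) F
      simpa only [hcc_def] using this
  have hWsqM : ∀ M : ℝ, (∀ᵐ t ∂(volume.restrict (Ioo 0 T)), ∫ x, ‖w t x‖ ^ 2 ≤ M) →
      ∀ t ∈ Icc 0 T, ∫ x, ‖W t x‖ ^ 2 ≤ M := by
    intro M hM t ht
    rw [integral_norm_sq_eq_sum_sq_apply _ (hWmem t ht.1)]
    have hP : ∀ i, HasSum (fun k : d → ℤ => ‖cc i t k‖ ^ 2) (∫ x, (W t x i) ^ 2) := by
      intro i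
      have hh := FunctionSpaces.Torus.hasSum_sq_norm_mFourierCoeff_ofReal (hf i t ht.1).1
      simp only [hWapp]
      convert hh using 1
      funext k
      rw [(hf i t ht.1).2 k]
    have hS : HasSum (fun k : d → ℤ => ∑ i, ‖cc i t k‖ ^ 2) (∑ i, ∫ x, (W t x i) ^ 2) := hasSum_sum fun i _ => hP i
    rw [← hS.tsum_eq]
    exact hS.summable.tsum_le_of_sum_le fun F => by
      have := hsumM M hM _ (hcl t) F
      simpa only [hcc_def] using this
  -- a.e. identification with `w`
  have hae : ∀ᵐ t ∂(volume.restrict (Ioo 0 T)), W t =ᵐ[volume] w t := by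
    filter_upwards [hcid, h.ae_memLp_two, ae_restrict_mem measurableSet_Ioo] with t ht htm htI
    have ht0 : 0 ≤ t := htI.1.le
    have hcomp : ∀ i, (fun x => f i t x) =ᵐ[volume] fun x => w t x i := by
      intro i
      refine ae_eq_of_forall_mFourierCoeff_ofReal_eq ((hf i t ht0).1.integrable one_le_two)
        ((memLp_two_coord htm i).integrable one_le_two) fun k => ?_
      rw [(hf i t ht0).2 k, hcc_def]
      show c i (Set.projIcc 0 T hT.le t : ℝ) k = _
      rw [hcl_eq t (Ioo_subset_Icc_self htI)]
      exact ht i k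
    have hall : ∀ᵐ x ∂volume, ∀ i, f i t x = w t x i := ae_all_iff.2 fun i => hcomp i
    filter_upwards [hall] with x hx
    ext i
    rw [hWapp, hx i]
  -- the value at `t = 0`
  have hW0 : W 0 =ᵐ[volume] w₀ := by
    have hcomp : ∀ i, (fun x => f i 0 x) =ᵐ[volume] fun x => w₀ x i := by
      intro i
      refine ae_eq_of_forall_mFourierCoeff_ofReal_eq ((hf i 0 le_rfl).1.integrable one_le_two)
        ((memLp_two_coord hw₀ i).integrable one_le_two) fun k => ?_
      rw [(hf i 0 le_rfl).2 k, hcc_def]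
      show c i (Set.projIcc 0 T hT.le 0 : ℝ) k = _
      rw [hcl_eq 0 (left_mem_Icc.2 hT.le)]
      exact hc0 i k
    have hall : ∀ᵐ x ∂volume, ∀ i, f i 0 x = w₀ x i := ae_all_iff.2 fun i => hcomp i
    filter_upwards [hall] with x hx
    ext i
    rw [hWapp, hx i]
  -- weak continuity on `[0,T]`
  have hWc : ∀ φ : UnitAddTorus d → EuclideanSpace ℝ d, MemLp φ 2 volume →
      ContinuousOn (fun t => ∫ x, ⟪W t x, φ x⟫_ℝ) (Icc 0 T) := by
    intro φ hφ
    have hcomp : ∀ i, ContinuousOn (fun t => ∫ x, W t x i * φ x i) (Icc 0 T) := fun i =>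
      continuousOn_integral_mul_of_coeff (S := Icc 0 T) (c := cc i) (w := fun t x => W t x i) (hcccI i)
        (fun t ht => by simp only [hWapp]; exact (hf i t ht.1).1)
        (fun t ht k => by simp only [hWapp]; exact (hf i t ht.1).2 k)
        (fun t ht => by
          have h1 := hWsq t ht.1
          rw [integral_norm_sq_eq_sum_sq_apply _ (hWmem t ht.1)] at h1
          exact le_trans (Finset.single_le_sum (f := fun j => ∫ x, (W t x j) ^ 2)
            (fun j _ => integral_nonneg fun x => sq_nonneg _) (Finset.mem_univ i)) h1)
        (memLp_two_coord hφ i)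
    have e : ∀ t ∈ Icc 0 T, ∫ x, ⟪W t x, φ x⟫_ℝ = ∑ i, ∫ x, W t x i * φ x i := by
      intro t ht
      rw [← integral_finsetSum _ fun i _ => ?_]
      · exact integral_congr_ae (ae_of_all _ fun x => inner_eq_sum_mul' (W t x) (φ x))
      · exact (memLp_two_coord (hWmem t ht.1) i).integrable_mul (memLp_two_coord hφ i)
    exact (continuousOn_finsetSum _ fun i _ => hcomp i).congr e
  -- weak divergence-freeness for every `t ∈ [0,T]`
  have hWdiv : ∀ t ∈ Icc 0 T, FunctionSpaces.Torus.IsWeaklyDivFree (W t) := by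
    intro t ht θ hθ
    have hgm : MemLp (FunctionSpaces.Torus.gradient θ) 2 volume := (FunctionSpaces.Torus.IsSmooth.gradient hθ).memLp 2
    have hEq := eqOn_Icc_of_ae_restrict_Ioo' (Y := ℝ) hT (hWc _ hgm) continuousOn_const
      (f := fun t => ∫ x, ⟪W t x, FunctionSpaces.Torus.gradient θ x⟫_ℝ) (g := fun _ => (0:ℝ)) ?_
    · exact hEq ht
    filter_upwards [hae, h.ae_isWeaklyDivFree] with τ hτ hτdiv
    rw [← hτdiv θ hθ]
    exact integral_congr_ae (hτ.mono fun x hx => by simp only [hx])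
  refine ⟨W, hWmem, ⟨C, hWsq⟩, hWsqM, hae, hW0, hWc, hWdiv, fun G hG hGdiv σ hσ => ?_⟩
  -- the trace identities: both sides continuous on `[0,T]`, equal a.e.
  set Φ : ℝ → ℝ := fun τ =>
    (∫ x, ⟪w τ x, FunctionSpaces.Torus.convect (b τ) G x + viscAdj 𝔸 G x⟫_ℝ) +
      A * ∫ x, ⟪b τ x, FunctionSpaces.Torus.convect (w τ) G x⟫_ℝ with hΦ
  have hΦi : IntegrableOn Φ (Ioo 0 T) volume := h.integrableOn_steadyRHS hG
  have hΦI : IntegrableOn Φ (Icc 0 T) volume := (integrableOn_Icc_iff_integrableOn_Ioo (f := Φ)).2 hΦi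
  have hPc : ContinuousOn (fun t => (∫ x, ⟪w₀ x, G x⟫_ℝ) + ∫ τ in Ioc 0 t, Φ τ) (Icc 0 T) :=
    continuousOn_const.add (intervalIntegral.continuousOn_primitive hΦI)
  have hEq : EqOn (fun t => ∫ x, ⟪W t x, G x⟫_ℝ) (fun t => (∫ x, ⟪w₀ x, G x⟫_ℝ) + ∫ τ in Ioc 0 t, Φ τ) (Icc 0 T) := by
    refine eqOn_Icc_of_ae_restrict_Ioo' (Y := ℝ) hT (hWc G (hG.memLp 2)) hPc ?_
    filter_upwards [hae, h.ae_integral_inner_eq hG hGdiv] with t ht htP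
    rw [← htP]
    exact integral_congr_ae (ht.mono fun x hx => by simp only [hx])
  exact hEq hσ

/-! ## Weakly continuous `L²` trajectories: uniqueness, and the algebra the window propagator needs -/

omit [DecidableEq d] in
/-- **A weakly continuous `L²` trajectory that vanishes a.e. in time vanishes at EVERY time.**  If `Z t ∈ L²` for
`t ∈ [0,T]`, `t ↦ ∫⟪Z t, φ⟫` is continuous on `[0,T]` for every `φ ∈ L²`, and `Z t = 0` a.e. in `x` for a.e. `t ∈ (0,T)`,
then `Z t = 0` a.e. in `x` for every `t ∈ [0,T]` (test with `φ = Z t`). [cite: Temam1984, Ch. III §1 Lemma 1.4] -/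
theorem ae_eq_zero_of_weaklyContinuous {T : ℝ} (hT : 0 < T) {Z : ℝ → UnitAddTorus d → EuclideanSpace ℝ d}
    (hmem : ∀ t ∈ Icc 0 T, MemLp (Z t) 2 volume)
    (hcont : ∀ φ : UnitAddTorus d → EuclideanSpace ℝ d, MemLp φ 2 volume →
      ContinuousOn (fun t => ∫ x, ⟪Z t x, φ x⟫_ℝ) (Icc 0 T))
    (hae : ∀ᵐ t ∂(volume.restrict (Ioo 0 T)), Z t =ᵐ[volume] 0) :
    ∀ t ∈ Icc 0 T, Z t =ᵐ[volume] 0 := by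
  intro t ht
  have hφ := hmem t ht
  have hEq := eqOn_Icc_of_ae_restrict_Ioo' (Y := ℝ) hT (hcont (Z t) hφ) continuousOn_const
    (f := fun s => ∫ x, ⟪Z s x, Z t x⟫_ℝ) (g := fun _ => (0:ℝ)) ?_
  · have h0 : ∫ x, ⟪Z t x, Z t x⟫_ℝ = 0 := hEq ht
    have h1 : ∫ x, ‖Z t x‖ ^ 2 = 0 := by
      rw [← h0]
      exact integral_congr_ae (ae_of_all _ fun x => (real_inner_self_eq_norm_sq (Z t x)).symm)
    have h2 : (fun x => ‖Z t x‖ ^ 2) =ᵐ[volume] 0 :=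
      (integral_eq_zero_iff_of_nonneg (fun x => sq_nonneg _) (hφ.integrable_norm_pow two_ne_zero)).1 h1
    filter_upwards [h2] with x hx
    have : ‖Z t x‖ = 0 := by
      have hx' : ‖Z t x‖ ^ 2 = 0 := hx
      exact pow_eq_zero_iff (n := 2) (by norm_num) |>.1 hx'
    exact norm_eq_zero.1 this
  · filter_upwards [hae] with s hs
    have e0 : (fun x => ⟪Z s x, Z t x⟫_ℝ) =ᵐ[volume] fun _ => (0:ℝ) :=
      hs.mono fun x hx => by simp only [hx, Pi.zero_apply, inner_zero_left]
    rw [integral_congr_ae e0, integral_zero]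

omit [DecidableEq d] in
/-- **Uniqueness of the weakly continuous representative, at every time**: two weakly continuous `L²` trajectories on
`[0,T]` that agree a.e. in `x` for a.e. `t ∈ (0,T)` agree a.e. in `x` at EVERY `t ∈ [0,T]`. [cite: Temam1984, Ch. III §1 Lemma 1.4] -/
theorem ae_eq_of_weaklyContinuous {T : ℝ} (hT : 0 < T) {W₁ W₂ : ℝ → UnitAddTorus d → EuclideanSpace ℝ d}
    (hmem₁ : ∀ t ∈ Icc 0 T, MemLp (W₁ t) 2 volume) (hmem₂ : ∀ t ∈ Icc 0 T, MemLp (W₂ t) 2 volume)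
    (hcont₁ : ∀ φ : UnitAddTorus d → EuclideanSpace ℝ d, MemLp φ 2 volume →
      ContinuousOn (fun t => ∫ x, ⟪W₁ t x, φ x⟫_ℝ) (Icc 0 T))
    (hcont₂ : ∀ φ : UnitAddTorus d → EuclideanSpace ℝ d, MemLp φ 2 volume →
      ContinuousOn (fun t => ∫ x, ⟪W₂ t x, φ x⟫_ℝ) (Icc 0 T))
    (hae : ∀ᵐ t ∂(volume.restrict (Ioo 0 T)), W₁ t =ᵐ[volume] W₂ t) :
    ∀ t ∈ Icc 0 T, W₁ t =ᵐ[volume] W₂ t := by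
  have key := ae_eq_zero_of_weaklyContinuous (d := d) hT (Z := fun t x => W₁ t x - W₂ t x)
    (fun t ht => (hmem₁ t ht).sub (hmem₂ t ht)) (fun φ hφ => ?_) ?_
  · intro t ht
    filter_upwards [key t ht] with x hx
    exact sub_eq_zero.1 hx
  · have e : ∀ t ∈ Icc 0 T, ∫ x, ⟪W₁ t x - W₂ t x, φ x⟫_ℝ = (∫ x, ⟪W₁ t x, φ x⟫_ℝ) - ∫ x, ⟪W₂ t x, φ x⟫_ℝ := by
      intro t ht
      rw [← integral_sub (integrable_inner_of_memLp_two_vec (hmem₁ t ht) hφ) (integrable_inner_of_memLp_two_vec (hmem₂ t ht) hφ)]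
      exact integral_congr_ae (ae_of_all _ fun x => inner_sub_left _ _ _)
    exact ((hcont₁ φ hφ).sub (hcont₂ φ hφ)).congr e
  · filter_upwards [hae] with t ht
    filter_upwards [ht] with x hx
    simp [hx]

/-- **Two weak solutions with the same datum have the same weakly continuous representative at EVERY time** (bounded
carrier, elliptic constant tensor: a.e. uniqueness `ae_eq_of_memLp_top` + `ae_eq_of_weaklyContinuous`). This is what makes
the window propagator well defined. [cite: Temam1984, Ch. III §1 Lemma 1.4] -/
theorem representative_ae_eq {T : ℝ} (hT : 0 < T) {lo hi : ℝ} (h𝔸 : NearIso 𝔸 lo hi) (hlo : 0 < lo)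
    {w₁ w₂ : ℝ → UnitAddTorus d → EuclideanSpace ℝ d}
    (h₁ : IsWeakTensorPassiveVectorOn A T 𝔸 b w₀ w₁) (h₂ : IsWeakTensorPassiveVectorOn A T 𝔸 b w₀ w₂)
    (hb : MemLp (FunctionSpaces.Torus.stLift b) ∞ (volume.restrict (Ioo 0 T ×ˢ univ)))
    {W₁ W₂ : ℝ → UnitAddTorus d → EuclideanSpace ℝ d}
    (hmem₁ : ∀ t ∈ Icc 0 T, MemLp (W₁ t) 2 volume) (hmem₂ : ∀ t ∈ Icc 0 T, MemLp (W₂ t) 2 volume)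
    (hcont₁ : ∀ φ : UnitAddTorus d → EuclideanSpace ℝ d, MemLp φ 2 volume →
      ContinuousOn (fun t => ∫ x, ⟪W₁ t x, φ x⟫_ℝ) (Icc 0 T))
    (hcont₂ : ∀ φ : UnitAddTorus d → EuclideanSpace ℝ d, MemLp φ 2 volume →
      ContinuousOn (fun t => ∫ x, ⟪W₂ t x, φ x⟫_ℝ) (Icc 0 T))
    (hae₁ : ∀ᵐ t ∂(volume.restrict (Ioo 0 T)), W₁ t =ᵐ[volume] w₁ t)
    (hae₂ : ∀ᵐ t ∂(volume.restrict (Ioo 0 T)), W₂ t =ᵐ[volume] w₂ t) :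
    ∀ t ∈ Icc 0 T, W₁ t =ᵐ[volume] W₂ t := by
  refine ae_eq_of_weaklyContinuous hT hmem₁ hmem₂ hcont₁ hcont₂ ?_
  filter_upwards [hae₁, hae₂, ae_eq_of_memLp_top h𝔸 hlo h₁ h₂ hb] with t h1 h2 h12
  exact h1.trans (h12.trans h2.symm)

/-- **Additivity of representatives**: the sum of weakly continuous representatives of two solutions is a weakly continuous
representative-type trajectory for the sum; hence (with `representative_ae_eq` and `IsWeakTensorPassiveVectorOn.add`) the
representative of the solution from `u₀ + v₀` is, at EVERY time, the sum of the representatives (linearity of the evolution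
operator). [cite: DiPernaLions1989, §II.1 (12)–(14)] -/
theorem representative_add {T : ℝ} (hT : 0 < T) {lo hi : ℝ} (h𝔸 : NearIso 𝔸 lo hi) (hlo : 0 < lo)
    {u₀ v₀ : UnitAddTorus d → EuclideanSpace ℝ d} {u v s : ℝ → UnitAddTorus d → EuclideanSpace ℝ d}
    (hu : IsWeakTensorPassiveVectorOn A T 𝔸 b u₀ u) (hv : IsWeakTensorPassiveVectorOn A T 𝔸 b v₀ v)
    (hs : IsWeakTensorPassiveVectorOn A T 𝔸 b (fun x => u₀ x + v₀ x) s)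
    (hu₀ : Integrable u₀ volume) (hv₀ : Integrable v₀ volume)
    (hb : MemLp (FunctionSpaces.Torus.stLift b) ∞ (volume.restrict (Ioo 0 T ×ˢ univ)))
    {U V S : ℝ → UnitAddTorus d → EuclideanSpace ℝ d}
    (hUm : ∀ t ∈ Icc 0 T, MemLp (U t) 2 volume) (hVm : ∀ t ∈ Icc 0 T, MemLp (V t) 2 volume)
    (hSm : ∀ t ∈ Icc 0 T, MemLp (S t) 2 volume)
    (hUc : ∀ φ : UnitAddTorus d → EuclideanSpace ℝ d, MemLp φ 2 volume → ContinuousOn (fun t => ∫ x, ⟪U t x, φ x⟫_ℝ) (Icc 0 T))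
    (hVc : ∀ φ : UnitAddTorus d → EuclideanSpace ℝ d, MemLp φ 2 volume → ContinuousOn (fun t => ∫ x, ⟪V t x, φ x⟫_ℝ) (Icc 0 T))
    (hSc : ∀ φ : UnitAddTorus d → EuclideanSpace ℝ d, MemLp φ 2 volume → ContinuousOn (fun t => ∫ x, ⟪S t x, φ x⟫_ℝ) (Icc 0 T))
    (hUae : ∀ᵐ t ∂(volume.restrict (Ioo 0 T)), U t =ᵐ[volume] u t)
    (hVae : ∀ᵐ t ∂(volume.restrict (Ioo 0 T)), V t =ᵐ[volume] v t)
    (hSae : ∀ᵐ t ∂(volume.restrict (Ioo 0 T)), S t =ᵐ[volume] s t) :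
    ∀ t ∈ Icc 0 T, S t =ᵐ[volume] fun x => U t x + V t x := by
  have hsum := hu.add hv hu₀ hv₀
  refine representative_ae_eq hT h𝔸 hlo hs hsum hb hSm (fun t ht => (hUm t ht).add (hVm t ht)) hSc (fun φ hφ => ?_) hSae ?_
  · have e : ∀ t ∈ Icc 0 T, ∫ x, ⟪U t x + V t x, φ x⟫_ℝ = (∫ x, ⟪U t x, φ x⟫_ℝ) + ∫ x, ⟪V t x, φ x⟫_ℝ := by
      intro t ht
      rw [← integral_add (integrable_inner_of_memLp_two_vec (hUm t ht) hφ) (integrable_inner_of_memLp_two_vec (hVm t ht) hφ)]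
      exact integral_congr_ae (ae_of_all _ fun x => inner_add_left _ _ _)
    exact ((hUc φ hφ).add (hVc φ hφ)).congr e
  · filter_upwards [hUae, hVae] with t h1 h2
    filter_upwards [h1, h2] with x hx1 hx2
    simp only [hx1, hx2]

/-- **Homogeneity of representatives** (same pattern with `IsWeakTensorPassiveVectorOn.const_smul`; linearity of the evolution
operator). [cite: DiPernaLions1989, §II.1 (12)–(14)] -/
theorem representative_smul {T : ℝ} (hT : 0 < T) {lo hi : ℝ} (h𝔸 : NearIso 𝔸 lo hi) (hlo : 0 < lo) (a : ℝ)
    {u₀ : UnitAddTorus d → EuclideanSpace ℝ d} {u s : ℝ → UnitAddTorus d → EuclideanSpace ℝ d}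
    (hu : IsWeakTensorPassiveVectorOn A T 𝔸 b u₀ u)
    (hs : IsWeakTensorPassiveVectorOn A T 𝔸 b (fun x => a • u₀ x) s)
    (hb : MemLp (FunctionSpaces.Torus.stLift b) ∞ (volume.restrict (Ioo 0 T ×ˢ univ)))
    {U S : ℝ → UnitAddTorus d → EuclideanSpace ℝ d}
    (hUm : ∀ t ∈ Icc 0 T, MemLp (U t) 2 volume) (hSm : ∀ t ∈ Icc 0 T, MemLp (S t) 2 volume)
    (hUc : ∀ φ : UnitAddTorus d → EuclideanSpace ℝ d, MemLp φ 2 volume → ContinuousOn (fun t => ∫ x, ⟪U t x, φ x⟫_ℝ) (Icc 0 T))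
    (hSc : ∀ φ : UnitAddTorus d → EuclideanSpace ℝ d, MemLp φ 2 volume → ContinuousOn (fun t => ∫ x, ⟪S t x, φ x⟫_ℝ) (Icc 0 T))
    (hUae : ∀ᵐ t ∂(volume.restrict (Ioo 0 T)), U t =ᵐ[volume] u t)
    (hSae : ∀ᵐ t ∂(volume.restrict (Ioo 0 T)), S t =ᵐ[volume] s t) :
    ∀ t ∈ Icc 0 T, S t =ᵐ[volume] fun x => a • U t x := by
  have hsm := hu.const_smul a
  refine representative_ae_eq hT h𝔸 hlo hs hsm hb hSm (fun t ht => (hUm t ht).const_smul a) hSc (fun φ hφ => ?_) hSae ?_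
  · have e : ∀ t ∈ Icc 0 T, ∫ x, ⟪a • U t x, φ x⟫_ℝ = a * ∫ x, ⟪U t x, φ x⟫_ℝ := by
      intro t ht
      rw [← integral_const_mul]
      exact integral_congr_ae (ae_of_all _ fun x => by simp only [real_inner_smul_left])
    exact ((hUc φ hφ).const_smul a |>.congr fun t ht => by rw [e t ht]; rfl)
  · filter_upwards [hUae] with t h1
    filter_upwards [h1] with x hx1
    simp only [hx1]

/-- **Restart from the representative**: the translate `τ ↦ w (σ + τ)` of a weak solution is a weak solution on `[0, T − σ)`
along the translated carrier from the representative's value `W σ`, for EVERY `σ ∈ [0,T)` (`translate_time` fed with the trace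
identities of `exists_weaklyContinuous_representative`). [cite: DiPernaLions1989, §II.1 (12)–(14)] -/
theorem translate_time_of_traces (h : IsWeakTensorPassiveVectorOn A T 𝔸 b w₀ w) {σ : ℝ} (hσ : 0 ≤ σ) (hσT : σ < T)
    {W : ℝ → UnitAddTorus d → EuclideanSpace ℝ d}
    (htr : ∀ G : UnitAddTorus d → EuclideanSpace ℝ d, FunctionSpaces.Torus.IsSmooth G → FunctionSpaces.Torus.IsDivFree G →
        ∀ σ' ∈ Icc 0 T, ∫ x, ⟪W σ' x, G x⟫_ℝ = (∫ x, ⟪w₀ x, G x⟫_ℝ) +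
          ∫ τ in Ioc 0 σ', ((∫ x, ⟪w τ x, FunctionSpaces.Torus.convect (b τ) G x + viscAdj 𝔸 G x⟫_ℝ) +
            A * ∫ x, ⟪b τ x, FunctionSpaces.Torus.convect (w τ) G x⟫_ℝ)) :
    IsWeakTensorPassiveVectorOn A (T - σ) 𝔸 (fun t => b (σ + t)) (W σ) (fun t => w (σ + t)) :=
  h.translate_time hσ hσT fun G hG hGdiv => htr G hG hGdiv σ ⟨hσ, hσT.le⟩

end IsWeakTensorPassiveVectorOn

end Torus

end Literature.Analysis.FluidPDE

end
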